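import Summits.MatrixMultiplication.MatrixMultiplication.Theorems.AbelianSTPPCensusShapeCertVQKFinal
import Summits.MatrixMultiplication.MatrixMultiplication.Theorems.AbelianSTPPCensusLeafTE471Closed
import Summits.MatrixMultiplication.MatrixMultiplication.Theorems.AbelianSTPPCensusShapeCertVQEvalK472
import Summits.MatrixMultiplication.MatrixMultiplication.Theorems.AbelianSTPPCensusShapeCertVQEvalK473
import Summits.MatrixMultiplication.MatrixMultiplication.Theorems.AbelianSTPPCensusShapeCertVQEvalK474
import Summits.MatrixMultiplication.MatrixMultiplication.Theorems.AbelianSTPPCensusShapeCertVQEvalK475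
import Summits.MatrixMultiplication.MatrixMultiplication.Theorems.AbelianSTPPCensusShapeCertVQEvalK476
import Summits.MatrixMultiplication.MatrixMultiplication.Theorems.AbelianSTPPCensusVQKWitness477

/-!
# Rung leaf F-M1.T_E beyond the vQ wall — no abelian STPP host of order ≤ 476 beats exponent 5/2

Cell mm-stpp, rung F-M1; successor kernel item «vQK T_E ladder beyond 471» (SUCCESSOR-BRIEF RIDER 20 (BB)) filed in support of the
closed crux item stmt-MatrixMultiplication-19191; seat mm-stpp-vp-p2 (gen 3).  Extends vp-p2 g2's `noAbelianSTPPHostUpTo_250_471`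
(`…LeafTE471Closed`; the registered instrument vQ := vP ∧ E3⁺ is exhausted there, `vqInstrumentTE_exact_471`) by the orders
`472 ≤ M ≤ 476` with the checker `ShapeCertVQ.checkQK` (`…ShapeCertVQKDefs`: g2's budgeted vQ search `checkQS` with ONE more node test,
the E3K kill — eng-2 g7's Kneser-sharpened three-room energy inequality `STPPThreeRoomEnergy.false_of_energy3k` on shape data,
`STPPThreeRoomEnergy.E3kAdm` / `e3kLHS`, sound for STPP families by `e3kAdm_of_isSTPP`, hereditary by `e3kLHS_mono`; soundness of the
checker `…ShapeCertVQKSemantics` / `…VQKSearch`, path segments `…VQKSearchP`, bridge `…ShapeCertVQKFinal`), kernel-evaluated order by order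
from planner-sized path segments (`…ShapeCertVQEvalK<M>a…`, `decide +kernel`, standard axioms, no `native_decide`) assembled in
`…ShapeCertVQEvalK<M>`.  Hence `shapeExclusionVQK_472_476`, `shapeExclusionVQK_le_476` and the named leaf
**`noAbelianSTPPHostUpTo_250_476 : NoAbelianSTPPHostUpTo (5/2) 476`**; and the successor instrument vQK := vP ∧ E3⁺ ∧ E3K certifies
T_E EXACTLY up to order `476` (`vqkInstrumentTE_exact_476`: it fails at `477` by eng-2 g7's `AbelianSTPPCensusVP.vqkCensusTE_false_above_477`,
the list `(8,6,6)⁴ + (5,4,3)` of `…VQKWitness477`).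
WHAT THIS IS NOT: no bound on `ω`; a rung leaf (finite range of a necessary condition), never summit credit; no existence claim (the
`477` list is instrument-alive, not a known STPP family); nothing about orders `≥ 477`; no new rule (vP, E3⁺, E3K are the cell's
sound theorems `sieveSound` / `u11GSound_holds` / `u11PSound`, `e3pAdm_of_isSTPP`, `e3kAdm_of_isSTPP`).
-/

set_option linter.dupNamespace false -- `MatrixMultiplication.MatrixMultiplication` (summit = problem, D-0017)
set_option autoImplicit false

namespace Summit.MatrixMultiplication.MatrixMultiplication.Theorems

open Finset STPPThreeRoomEnergy

/-- **The vQK certificate `checkQK` holds at every order `472 ≤ M ≤ 476`.** [original] -/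
theorem ShapeCertVQ.checkQK_472_476 (M : ℕ) (h₁ : 472 ≤ M) (h₂ : M ≤ 476) : ShapeCertVQ.checkQK M = true := by
  interval_cases M
  · exact ShapeCertVQ.checkQK_472
  · exact ShapeCertVQ.checkQK_473
  · exact ShapeCertVQ.checkQK_474
  · exact ShapeCertVQ.checkQK_475
  · exact ShapeCertVQ.checkQK_476

/-- **vQK shape exclusion for `T_E` (`τ = 5/2`) at the orders `472 ≤ M ≤ 476`**: no shape list with at least two members that
satisfies the vP sieve system, the E3⁺ condition and the E3K condition beats `5/2`. [original] -/
theorem shapeExclusionVQK_472_476 : ∀ (N M : ℕ) (a b c : Fin N → ℕ), 2 ≤ N → 472 ≤ M → M ≤ 476 →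
    SieveAdmissibleVP M a b c → E3pAdm M a b c → E3kAdm M a b c → ¬ Beats (5 / 2) M a b c :=
  fun N M a b c hN h₁ h₂ =>
    ShapeCertVQ.shapeExclusionVQK_of_checkQK (by omega) (ShapeCertVQ.checkQK_472_476 M h₁ h₂) N a b c hN

/-- **vQK shape exclusion for `T_E` at every order `M ≤ 476`** (`≤ 471`: the vQ range `vqInstrumentTE_exact_471` of `…LeafTE471Closed`,
which does not even use E3K; `472 … 476`: `shapeExclusionVQK_472_476`). [original] -/
theorem shapeExclusionVQK_le_476 : ∀ (N M : ℕ) (a b c : Fin N → ℕ), 2 ≤ N → M ≤ 476 →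
    SieveAdmissibleVP M a b c → E3pAdm M a b c → E3kAdm M a b c → ¬ Beats (5 / 2) M a b c := by
  intro N M a b c hN hM hVP hE hK
  rcases Nat.lt_or_ge M 472 with h | h
  · exact vqInstrumentTE_exact_471.1 N M a b c hN (by omega) hVP hE
  · exact shapeExclusionVQK_472_476 N M a b c hN h hM hVP hE hK

/-- **Rung leaf T_E/476 (closed, beyond the vQ wall).** No finite abelian group of order at most `476` hosts an STPP family
beating exponent `5/2`: `Σ_i (|A_i||B_i||C_i|)^{5/6} ≤ |H|` for every STPP family in every such `H`.  Orders `≤ 471` by name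
(`noAbelianSTPPHostUpTo_250_471`); `472 … 476`: every STPP family with non-empty sets has vP-admissible (`sieveSound`, `u11GSound_holds`,
`u11PSound`), E3⁺-admissible (`e3pAdm_of_isSTPP`) and E3K-admissible (`e3kAdm_of_isSTPP`) shape data, which the vQK certificate
excludes from beating. [original] -/
theorem noAbelianSTPPHostUpTo_250_476 : NoAbelianSTPPHostUpTo (5 / 2) 476 := by
  classical
  refine AbelianTECensus.noAbelianSTPPHostUpTo_of_two (τ := 5 / 2) (by norm_num) (by norm_num) ?_
  intro H _ _ hM N A B C hS hne hN
  by_cases h471 : Fintype.card H ≤ 471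
  · exact noAbelianSTPPHostUpTo_250_471 H h471 N A B C hS
  · have hadm : SieveAdmissibleVP (Fintype.card H) (fun i => (A i).card) (fun i => (B i).card) (fun i => (C i).card) :=
      ⟨AbelianTECensus.sieveSound H N A B C hS hne, u11GSound_holds H N A B C hS hne,
        fun hp => STPPRepCount.u11PSound H hp N A B C hS hne⟩
    have hE : E3pAdm (Fintype.card H) (fun i => (A i).card) (fun i => (B i).card) (fun i => (C i).card) :=
      e3pAdm_of_isSTPP hS hne
    have hK : E3kAdm (Fintype.card H) (fun i => (A i).card) (fun i => (B i).card) (fun i => (C i).card) :=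
      e3kAdm_of_isSTPP hS hne
    have h := shapeExclusionVQK_472_476 N (Fintype.card H) _ _ _ hN (by omega) hM hadm hE hK
    unfold Beats at h
    push Not at h
    simpa [shapeVol] using h

/-- **The successor instrument vQK := vP ∧ E3⁺ ∧ E3K certifies T_E EXACTLY up to order 476**: at every order `M ≤ 476` no shape
list with at least two members that is vP-, E3⁺- and E3K-admissible beats `5/2` (`shapeExclusionVQK_le_476`), and at order `477` one
does (eng-2 g7's `AbelianSTPPCensusVP.vqkCensusTE_false_above_477`: the list `(8,6,6)⁴ + (5,4,3)` of `…VQKWitness477`, E3K slack `124`).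
So the first vQK-alive order for T_E is exactly `477` — both ends kernel theorems. [original] -/
theorem vqkInstrumentTE_exact_476 :
    (∀ (N M : ℕ) (a b c : Fin N → ℕ), 2 ≤ N → M ≤ 476 → SieveAdmissibleVP M a b c → E3pAdm M a b c → E3kAdm M a b c →
        ¬ Beats (5 / 2) M a b c) ∧
    ¬ (∀ (N M : ℕ) (a b c : Fin N → ℕ), 2 ≤ N → M ≤ 477 → SieveAdmissibleVP M a b c → E3pAdm M a b c → E3kAdm M a b c →
        ¬ Beats (5 / 2) M a b c) :=
  ⟨shapeExclusionVQK_le_476, AbelianSTPPCensusVP.vqkCensusTE_false_above_477 le_rfl⟩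

end Summit.MatrixMultiplication.MatrixMultiplication.Theorems
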